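import Mathlib
import Literature.NumberTheory.Transcendental.GelfondDiazHolds

/-!
# Line `sector-split` (route `RigidCore`): Diaz's count on the Gel'fond ladder (stub C6)

Prover file for the registered stub C6 `stub_diazLadderCount` of line `sector-split`
(skeleton v15) of crux `stmt-Schanuel-0970`
(`Summit.Schanuel.Schanuel.Theses.RigidCore.SchanuelOnLogFreeCore`, (R): Schanuel's conjecture for
`ℚ`-linearly independent tuples from the log-free core `C_EA`).

CALIBRATION.  The Gel'fond ladder `x = (βᵏ · rπi)_{1 ≤ k ≤ d-1}` (`β` algebraic of degree
`d ≥ 2`, `r ∈ ℚ*`) is a core tuple on which (R) demands transcendence degree `d - 1`; this file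
records that it already carries Diaz's UNCONDITIONAL count: the Schanuel field `ℚ(x, eˣ)` has
transcendence degree at least `⌊(d+1)/2⌋` (Diaz 1989, main theorem; Gel'fond 1949 for `d = 3`).

Proof: Diaz's theorem, PROVED in the tree as
`Literature.NumberTheory.Transcendental.Diaz1989_holds` (`GelfondDiazHolds.lean`), at base
`a = e^{rπi}` (a root of unity, hence algebraic: `(e^{rπi})^{2 den r} = e^{2πi · num r} = 1`) with
the nonzero logarithm `l = rπi` and `b = β`: the Gelfond powers `e^{βᵏ l} = a^{βᵏ}`,
`1 ≤ k ≤ d - 1`, are exactly the exponentials `e^{x_k}` of the ladder, so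
`ℚ(gelfondPowers β l d) ≤ ℚ(x, eˣ)` and the transcendence degree is monotone along this inclusion.

Contents (auxiliaries in the sub-namespace `DiazLadder`):

* `DiazLadder.isAlgebraic_exp_rat_mul_pi_mul_I` : `e^{rπi}` is algebraic for `r ∈ ℚ`;
* `DiazLadder.rat_mul_pi_mul_I_ne_zero` : `rπi ≠ 0` for `r ≠ 0`;
* `DiazLadder.isAlgebraic_of_natDegree_minpoly` : `deg (minpoly ℚ β) = d ≥ 2 ⟹ β` algebraic;
* `DiazLadder.trdeg_adjoin_mono` : `S ⊆ T ⟹ trdeg_ℚ ℚ(S) ≤ trdeg_ℚ ℚ(T)`;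
* `DiazLadder.le_trdeg_of_exp_ladder` : Diaz's count for any tuple `x` with `x_k = βᵏ⁺¹ l`,
  `e^l` algebraic, `l ≠ 0`;
* `stub_diazLadderCount` : the registered stub (signature verbatim);
* `DiazLadder.cruxCell_gelfondCubic` : the case `d = 3` (Gel'fond 1949): for `β` cubic the cell
  `x = (βrπi, β²rπi)` of (R) has `trdeg_ℚ ℚ(x, eˣ) ≥ 2`, a settled rank-2 cell;
* `DiazLadder.irreducible_X_pow_three_sub_C_two`, `DiazLadder.natDegree_minpoly_two_cpow_third`,
  `DiazLadder.cruxCell_twoCpowThird` : the concrete cell `β = 2^{1/3}`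
  (`minpoly ℚ 2^{1/3} = X³ − 2`, irreducible since `2` is not a rational cube — `2`-adic
  valuation).

Everything used is proved in the tree (`Diaz1989_holds`) or in Mathlib; no new definitions, no
hypotheses of `Prop`-valued definitions.
-/

noncomputable section

namespace Summit.Schanuel.Schanuel.Theorems.RigidCore

open Complex IntermediateField
open Literature.NumberTheory.Transcendental

namespace DiazLadder

/-- `e^{rπi}` is algebraic for every rational `r`: it is a root of unity,
`(e^{rπi})^{2 · den r} = e^{(num r) · 2πi} = 1`. [folklore] -/
theorem isAlgebraic_exp_rat_mul_pi_mul_I (r : ℚ) :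
    IsAlgebraic ℚ (cexp ((r : ℂ) * (↑Real.pi * I))) := by
  refine IsAlgebraic.of_pow (Nat.mul_pos two_pos r.den_pos) ?_
  rw [← Complex.exp_nat_mul]
  have h : ((2 * r.den : ℕ) : ℂ) * ((r : ℂ) * (↑Real.pi * I)) = (r.num : ℂ) * (2 * ↑Real.pi * I) := by
    have h2 : ((r.den : ℚ) : ℂ) * (r : ℂ) = ((r.num : ℚ) : ℂ) := by
      rw [← Rat.cast_mul, Rat.den_mul_eq_num]
    push_cast at h2 ⊢
    linear_combination (2 * ↑Real.pi * I) * h2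
  rw [h, Complex.exp_int_mul_two_pi_mul_I]
  exact isAlgebraic_one

/-- `rπi ≠ 0` for a nonzero rational `r`. [folklore] -/
theorem rat_mul_pi_mul_I_ne_zero {r : ℚ} (hr : r ≠ 0) : (r : ℂ) * (↑Real.pi * I) ≠ 0 :=
  mul_ne_zero (by exact_mod_cast hr)
    (mul_ne_zero (by exact_mod_cast Real.pi_ne_zero) Complex.I_ne_zero)

/-- If `minpoly ℚ β` has degree `d ≥ 2` (indeed `d ≠ 0` suffices) then `β` is algebraic: a
non-integral element has `minpoly = 0`, of degree `0`. [folklore] -/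
theorem isAlgebraic_of_natDegree_minpoly {β : ℂ} {d : ℕ} (hd : (minpoly ℚ β).natDegree = d)
    (h2 : 2 ≤ d) : IsAlgebraic ℚ β := by
  have hint : IsIntegral ℚ β := by
    by_contra h
    rw [minpoly.eq_zero h, Polynomial.natDegree_zero] at hd
    omega
  exact hint.isAlgebraic

/-- Monotonicity of the transcendence degree of generated subfields of `ℂ` along an inclusion of
the generating sets (Mathlib's `trdeg_le_of_injective` for `IntermediateField.inclusion`).
[folklore] -/
theorem trdeg_adjoin_mono {S T : Set ℂ} (h : S ⊆ T) :
    Algebra.trdeg ℚ ↥(adjoin ℚ S) ≤ Algebra.trdeg ℚ ↥(adjoin ℚ T) :=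
  trdeg_le_of_injective (inclusion (adjoin.mono ℚ S T h))
    (inclusion_injective (adjoin.mono ℚ S T h))

/-- **Diaz's count on an exponential ladder.** If `e^l` is algebraic, `l ≠ 0`, `β` has
`deg (minpoly ℚ β) = d ≥ 2` and `x_k = β^{k+1} l` (`0 ≤ k < d - 1`), then
`trdeg_ℚ ℚ(x, eˣ) ≥ ⌊(d+1)/2⌋`: the Gelfond powers `e^{β^{k+1} l}` are the `e^{x_k}`, and Diaz's
theorem (`Diaz1989_holds`) bounds the transcendence degree of the field they generate.
[cite: Diaz1989, main theorem (Théorème 1)] -/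
theorem le_trdeg_of_exp_ladder {β l : ℂ} {d : ℕ} (hl : IsAlgebraic ℚ (cexp l)) (hl0 : l ≠ 0)
    (hd : (minpoly ℚ β).natDegree = d) (h2 : 2 ≤ d) (x : Fin (d - 1) → ℂ)
    (hx : ∀ k, x k = β ^ ((k : ℕ) + 1) * l) :
    (((d + 1) / 2 : ℕ) : Cardinal) ≤
      Algebra.trdeg ℚ ↥(adjoin ℚ (Set.range x ∪ Set.range (cexp ∘ x))) := by
  have hD := Diaz1989_holds hl (isAlgebraic_of_natDegree_minpoly hd h2) rfl hl0 d hd h2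
  refine hD.trans (trdeg_adjoin_mono ?_)
  rintro _ ⟨k, rfl⟩
  refine Or.inr ⟨k, ?_⟩
  show cexp (x k) = gelfondPowers β l d k
  rw [gelfondPowers_apply, hx k]

end DiazLadder

/-- **Registered stub C6 `stub_diazLadderCount` of line `sector-split`** (signature verbatim):
on the Gel'fond ladder `x = (βᵏ · rπi)_{1 ≤ k ≤ d-1}` (`β` algebraic of degree `d ≥ 2`,
`r ∈ ℚ*`) the Schanuel field `ℚ(x, eˣ)` has transcendence degree at least `⌊(d+1)/2⌋` — Diaz's
theorem at base `a = e^{rπi}` (a root of unity, algebraic) with logarithm `l = rπi ≠ 0`: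
`e^{x_k} = a^{βᵏ}`. [cite: Diaz1989, main theorem (Théorème 1)] -/
theorem stub_diazLadderCount :
    ∀ (β : ℂ) (r : ℚ) (d : ℕ), (minpoly ℚ β).natDegree = d → 2 ≤ d → r ≠ 0 →
      ∀ x : Fin (d - 1) → ℂ,
        (∀ k, x k = β ^ ((k : ℕ) + 1) * ((r : ℂ) * (↑Real.pi * Complex.I))) →
        (((d + 1) / 2 : ℕ) : Cardinal) ≤ Algebra.trdeg ℚ
          ↥(IntermediateField.adjoin ℚ (Set.range x ∪ Set.range (Complex.exp ∘ x))) := by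
  intro β r d hd h2 hr x hx
  exact DiazLadder.le_trdeg_of_exp_ladder (DiazLadder.isAlgebraic_exp_rat_mul_pi_mul_I r)
    (DiazLadder.rat_mul_pi_mul_I_ne_zero hr) hd h2 x hx

namespace DiazLadder

/-- **Gel'fond 1949 as a settled rank-2 cell of (R)** (the stub at `d = 3`): for `β` cubic
(`deg (minpoly ℚ β) = 3`) and `r ∈ ℚ*`, the core tuple `x = (βrπi, β²rπi)` has
`trdeg_ℚ ℚ(x, eˣ) ≥ 2 = ⌊(3+1)/2⌋`, i.e. `a^β, a^{β²}` (`a = e^{rπi}`) are algebraically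
independent. [cite: Gelfond1949] -/
theorem cruxCell_gelfondCubic (β : ℂ) (r : ℚ) (hd : (minpoly ℚ β).natDegree = 3) (hr : r ≠ 0)
    (x : Fin 2 → ℂ) (hx : ∀ k, x k = β ^ ((k : ℕ) + 1) * ((r : ℂ) * (↑Real.pi * Complex.I))) :
    (2 : Cardinal) ≤
      Algebra.trdeg ℚ ↥(IntermediateField.adjoin ℚ (Set.range x ∪ Set.range (Complex.exp ∘ x))) := by
  have h := stub_diazLadderCount β r 3 hd (by norm_num) hr x hx
  simpa using h

/-! ### The concrete cell `β = 2^{1/3}` -/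

open Polynomial in
/-- `X³ − 2` is irreducible over `ℚ`: by Kummer (`X_pow_sub_C_irreducible_of_prime`) it suffices
that `2` is not a rational cube, and the `2`-adic valuation of a cube is divisible by `3` while
`v₂(2) = 1` (this arithmetic input is also the landed
`Literature.Barriers.HodgeConjecture.rat_pow_three_ne_two`, not imported here to keep the cone of
this file free of the Hodge-theory modules). [folklore] -/
theorem irreducible_X_pow_three_sub_C_two : Irreducible (X ^ 3 - C (2 : ℚ)) := by
  refine X_pow_sub_C_irreducible_of_prime Nat.prime_three fun b h => ?_
  have h2 : padicValRat 2 ((2 : ℕ) : ℚ) = 1 := padicValRat.self one_lt_two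
  rw [Nat.cast_ofNat, ← h, padicValRat.pow] at h2
  push_cast at h2
  omega

open Polynomial in
/-- The minimal polynomial of `2^{1/3}` (principal branch) over `ℚ` is `X³ − 2`. [folklore] -/
theorem minpoly_two_cpow_third : minpoly ℚ ((2 : ℂ) ^ (1 / 3 : ℂ)) = X ^ 3 - C (2 : ℚ) := by
  refine (minpoly.eq_of_irreducible_of_monic irreducible_X_pow_three_sub_C_two ?_
    (monic_X_pow_sub_C _ three_ne_zero)).symm
  simp

/-- `2^{1/3}` is cubic: `deg (minpoly ℚ 2^{1/3}) = 3`. [folklore] -/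
theorem natDegree_minpoly_two_cpow_third : (minpoly ℚ ((2 : ℂ) ^ (1 / 3 : ℂ))).natDegree = 3 := by
  rw [minpoly_two_cpow_third, Polynomial.natDegree_X_pow_sub_C]

/-- **The concrete Gel'fond cell of (R)**: for `β = 2^{1/3}` and `r ∈ ℚ*` the core tuple
`x = (2^{1/3} rπi, 2^{2/3} rπi)` has `trdeg_ℚ ℚ(x, eˣ) ≥ 2` — e.g. (`r = 1`) the numbers
`(-1)^{2^{1/3}} = e^{2^{1/3}πi}` and `(-1)^{2^{2/3}}` are algebraically independent (Gel'fond 1949).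
[cite: Gelfond1949] -/
theorem cruxCell_twoCpowThird (r : ℚ) (hr : r ≠ 0) (x : Fin 2 → ℂ)
    (hx : ∀ k, x k = ((2 : ℂ) ^ (1 / 3 : ℂ)) ^ ((k : ℕ) + 1) * ((r : ℂ) * (↑Real.pi * Complex.I))) :
    (2 : Cardinal) ≤
      Algebra.trdeg ℚ ↥(IntermediateField.adjoin ℚ (Set.range x ∪ Set.range (Complex.exp ∘ x))) :=
  cruxCell_gelfondCubic _ r natDegree_minpoly_two_cpow_third hr x hx

end DiazLadder

end Summit.Schanuel.Schanuel.Theorems.RigidCore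

end
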